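import Summits.QuantumFields.YangMills.Theorems.BalabanUVNodesPortU8LocUnivPackageClauses34
import Summits.QuantumFields.YangMills.Theorems.BalabanUVNodesPortU8LocUnivDecayClause4

/-!
# Port piece U8 — THE SELECTOR-FREE PACKAGE WITH (‴-LocUniv) CLAUSES 1, 2 AND 4 DISCHARGED: ★★★ `portPieceLocalityU8_LocUniv_of_clause3`
# (displayed inputs now: clause 3 of (‴-LocUniv) — the Laplacian face `Σ_ν` second differences at rate η³ — and (Tok-cmpU-cap) ONLY)

Cell `ym-nodeO-ideate` ∕ `ym-balaban-port`, porter `ymgap-nodeO-port-PTB-1` (gen 4).  JOIN-side helper for **stmt-QuantumFields-27238** (K0ᴬ), `--supports … --as helper`.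
[15] = [Balaban1985Variational], [B5] = [Balaban1984PropagatorsI], [B6] = [Balaban1984PropagatorsII].

WHAT IS PROVED (kernel, sorry-free).
§1 `hk2_recordK₀` — the spare level at the port's volumes: `k + 2 ≤ m + (recordK₀ F Mc k + n)` (`recordK₀ = k + 1 + log_L Mc`, `m ≥ 1`).
§2 ★★ `h34_of_clause3` — the clauses-3–4 hypothesis `h34` of ✓`portPieceLocalityU8_LocUniv_of_clauses34` from clause 3 alone: clause 4 is ✓`norm_recordHrLocξ_univ_curlStencil_le`
   (g4, from r03's [B6] (2.148)∕(2.150) rows), constants merged by `max`∕`min` (✓`decayBound_weaken`).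
§3 ★★★ `portPieceLocalityU8_LocUniv_of_clause3` — the selector-free U8 package (C1)ᵀ + (C2a)(C2b)ᵀ + (E4a)ᵀ with displayed inputs clause 3 + (Tok-cmpU-cap).

HONEST FRAMING.  Bookkeeping over proved tree theorems; clause 3 ([15] (190) third line — needs (137) + (140) `∂∂*H`, the latter NOT in the tree) and (Tok-cmpU-cap) stay DISPLAYED;
nothing of Bałaban's renormalization-group analysis asserted; K0ᴬ 27238 OPEN; NODE O 0∕1; COUNT 8∕28 · K 1∕4 UNMOVED; finite `𝕋⁴_{L^K}` at fixed ε — NOT continuum ∕ OS ∕ Clay;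
**the Yang–Mills mass gap (Clay) is NOT proved by any of this.**
-/

noncomputable section

open scoped BigOperators Matrix.Norms.L2Operator

namespace Summit.QuantumFields.YangMills.Theorems.PortU8

open Literature.MathematicalPhysics.QuantumFieldTheory.Balaban1983to89
open Literature.MathematicalPhysics.QuantumFieldTheory.Balaban1983to89.Node00
open Literature.MathematicalPhysics.QuantumFieldTheory.Balaban1983to89.T4Continuum (T4Family)
open Summit.QuantumFields.YangMills.Theorems.K0RecordFormatNames

variable (F : T4Family)

/-! ## §1  The spare level at the port's volumes -/

/-- At the port's volumes `K = recordK₀ F Mc k + n` there is always one spare level above `k + 1`: `k + 2 ≤ m + K`. [cite: Balaban1987RG1, p.257 (bookkeeping)] -/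
theorem hk2_recordK₀ (Mc k n : ℕ) : k + 1 + 1 ≤ (F.P (recordK₀ F Mc k + n)).m + (F.P (recordK₀ F Mc k + n)).K := by
  have hm := F.hm
  simp only [T4Family.P_m, T4Family.P_K, recordK₀]
  omega

/-! ## §2  ★★ The clauses-3–4 hypothesis from clause 3 alone -/

/-- ★★ **`h34` FROM CLAUSE 3**: the displayed clauses-3–4 hypothesis of ✓`portPieceLocalityU8_LocUniv_of_clauses34` follows from its clause-3 half — clause 4 is the PROVED
✓`norm_recordHrLocξ_univ_curlStencil_le` at the port's volumes (§1), constants merged by `max`∕`min`.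
[cite: Balaban1985Variational, (190) p.308, (137) p.298; Balaban1984PropagatorsII, (2.148)-(2.150) p.249; Balaban1987RG1, (4.35) p.290] -/
theorem h34_of_clause3 (Mc : ℕ) (a₀ : ℝ)
    (h3 : ∃ C₉' δ₉ : ℝ, 0 ≤ C₉' ∧ 0 < δ₉ ∧ ∀ (k n : ℕ) (ε₂₉ : ℝ), 0 < ε₂₉ → letI θ := thetaFill F a₀ ε₂₉; letI := θ.instVβ₁; letI := θ.instVβ₂; letI := θ.instιβ;
      ∀ (a : θ.ιβ) (μ : Fin (F.P (recordK₀ F Mc k + n)).d) (y : Site (F.P (recordK₀ F Mc k + n)) (k + 1)),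
      letI Hr : PBond (F.P (recordK₀ F Mc k + n)) 0 → Fin 2 → Fin 2 → ℂ := fun b' => recordHrLocξ F θ k (recordK₀ F Mc k + n) Finset.univ a (μ, y) b';
      ∀ b : PBond (F.P (recordK₀ F Mc k + n)) 0,
        ‖∑ ν : Fin (F.P (recordK₀ F Mc k + n)).d, (Hr ⟨b.src.shift ν, b.dir⟩ - (2 : ℂ) • Hr b + Hr ⟨b.src.unshift ν, b.dir⟩)‖ ≤
          C₉' * (F.P (recordK₀ F Mc k + n)).eta (k + 1) ^ 3 * Real.exp (-(δ₉ * (Site.tdist (coarsenTo (k + 1) b.src) y : ℝ))))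
    :
    ∃ C₉' δ₉ : ℝ, 0 ≤ C₉' ∧ 0 < δ₉ ∧ ∀ (k n : ℕ) (ε₂₉ : ℝ), 0 < ε₂₉ → letI θ := thetaFill F a₀ ε₂₉; letI := θ.instVβ₁; letI := θ.instVβ₂; letI := θ.instιβ;
      ∀ (a : θ.ιβ) (μ : Fin (F.P (recordK₀ F Mc k + n)).d) (y : Site (F.P (recordK₀ F Mc k + n)) (k + 1)),
      letI Hr : PBond (F.P (recordK₀ F Mc k + n)) 0 → Fin 2 → Fin 2 → ℂ := fun b' => recordHrLocξ F θ k (recordK₀ F Mc k + n) Finset.univ a (μ, y) b';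
      ∀ b : PBond (F.P (recordK₀ F Mc k + n)) 0,
        ‖∑ ν : Fin (F.P (recordK₀ F Mc k + n)).d, (Hr ⟨b.src.shift ν, b.dir⟩ - (2 : ℂ) • Hr b + Hr ⟨b.src.unshift ν, b.dir⟩)‖ ≤
          C₉' * (F.P (recordK₀ F Mc k + n)).eta (k + 1) ^ 3 * Real.exp (-(δ₉ * (Site.tdist (coarsenTo (k + 1) b.src) y : ℝ))) ∧
        ‖∑ ν : Fin (F.P (recordK₀ F Mc k + n)).d, ((Hr ⟨b.src, b.dir⟩ + Hr ⟨(b.src).shift b.dir, ν⟩ - Hr ⟨(b.src).shift ν, b.dir⟩ - Hr ⟨b.src, ν⟩) -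
          (Hr ⟨b.src.unshift ν, b.dir⟩ + Hr ⟨(b.src.unshift ν).shift b.dir, ν⟩ - Hr ⟨(b.src.unshift ν).shift ν, b.dir⟩ - Hr ⟨b.src.unshift ν, ν⟩))‖ ≤
          C₉' * (F.P (recordK₀ F Mc k + n)).eta (k + 1) ^ 3 * Real.exp (-(δ₉ * (Site.tdist (coarsenTo (k + 1) b.src) y : ℝ))) := by
  obtain ⟨C₃, δ₃, hC₃, hδ₃, h3'⟩ := h3
  obtain ⟨C₄, δ₄, hC₄, hδ₄, h4⟩ := norm_recordHrLocξ_univ_curlStencil_le F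
  refine ⟨max C₃ C₄, min δ₃ δ₄, hC₃.trans (le_max_left _ _), lt_min hδ₃ hδ₄, fun k n ε₂₉ hε a μ y b => ⟨?_, ?_⟩⟩
  · have hη0 : 0 ≤ (F.P (recordK₀ F Mc k + n)).eta (k + 1) := by
      unfold Params.eta; exact (pow_pos (inv_pos.2 (F.P (recordK₀ F Mc k + n)).cast_L_pos) _).le
    exact (h3' k n ε₂₉ hε a μ y b).trans
      (decayBound_weaken (le_max_left _ _) hC₃ (min_le_left _ _) (pow_nonneg hη0 3) (Nat.cast_nonneg _))
  · have hη0 : 0 ≤ (F.P (recordK₀ F Mc k + n)).eta (k + 1) := by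
      unfold Params.eta; exact (pow_pos (inv_pos.2 (F.P (recordK₀ F Mc k + n)).cast_L_pos) _).le
    exact (h4 a₀ ε₂₉ (recordK₀ F Mc k + n) k (hk2_recordK₀ F Mc k n) a μ y b).trans
      (decayBound_weaken (le_max_right _ _) hC₄ (min_le_right _ _) (pow_nonneg hη0 3) (Nat.cast_nonneg _))

/-! ## §3  ★★★ The selector-free U8 package with clauses 1, 2, 4 discharged -/

/-- ★★★ **THE SELECTOR-FREE U8 PACKAGE ON THE TRANSVERSE TABLE, CLAUSES 1, 2, 4 OF (‴-LocUniv) DISCHARGED**: under the displayed clause 3 of (‴-LocUniv) (the Laplacian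
face `Σ_ν` second differences of `recordHrLocξ … Finset.univ a (μ, y)` at rate `η³ e^{−δ·tdist}`) and (Tok-cmpU-cap), the conclusion of ✓`portPieceLocalityU8_LocUniv` verbatim.
[cite: Balaban1985Variational, Prop. 9 p.309, (190) p.308, (137) p.298; Balaban1987RG1, (1.21) p.264, (4.4)–(4.5) pp.281–282, (4.35) p.290; Balaban1984PropagatorsI, (1.63) p.30; Balaban1984PropagatorsII, (2.35) p.228, (2.148)-(2.150) p.249] -/
theorem portPieceLocalityU8_LocUniv_of_clause3 (Mc : ℕ) (a₀ : ℝ) (hMc : McGuard F Mc)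
    (h3 : ∃ C₉' δ₉ : ℝ, 0 ≤ C₉' ∧ 0 < δ₉ ∧ ∀ (k n : ℕ) (ε₂₉ : ℝ), 0 < ε₂₉ → letI θ := thetaFill F a₀ ε₂₉; letI := θ.instVβ₁; letI := θ.instVβ₂; letI := θ.instιβ;
      ∀ (a : θ.ιβ) (μ : Fin (F.P (recordK₀ F Mc k + n)).d) (y : Site (F.P (recordK₀ F Mc k + n)) (k + 1)),
      letI Hr : PBond (F.P (recordK₀ F Mc k + n)) 0 → Fin 2 → Fin 2 → ℂ := fun b' => recordHrLocξ F θ k (recordK₀ F Mc k + n) Finset.univ a (μ, y) b';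
      ∀ b : PBond (F.P (recordK₀ F Mc k + n)) 0,
        ‖∑ ν : Fin (F.P (recordK₀ F Mc k + n)).d, (Hr ⟨b.src.shift ν, b.dir⟩ - (2 : ℂ) • Hr b + Hr ⟨b.src.unshift ν, b.dir⟩)‖ ≤
          C₉' * (F.P (recordK₀ F Mc k + n)).eta (k + 1) ^ 3 * Real.exp (-(δ₉ * (Site.tdist (coarsenTo (k + 1) b.src) y : ℝ))))
    (hcmp : ∃ C₉' δ₉ : ℝ, 0 ≤ C₉' ∧ 0 < δ₉ ∧ ∀ (k n : ℕ) (ε₂₉ : ℝ), 0 < ε₂₉ → letI θ := thetaFill F a₀ ε₂₉; letI := θ.instVβ₁; letI := θ.instVβ₂; letI := θ.instιβ;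
      ∀ (a : θ.ιβ) (μ : Fin (F.P (recordK₀ F Mc k + n)).d) (y : Site (F.P (recordK₀ F Mc k + n)) (k + 1)),
      ∀ R3 R0 : ℕ, R3 + nestRadius Mc 1 ≤ R0 → 2 * (R0 + 1) < (F.P (recordK₀ F Mc k + n)).sitesPerDir (k + 1) → ∀ z₀ : Fin 4 → ℤ, y ∈ recordWindow F k (recordK₀ F Mc k + n) R3 z₀ →
      letI Hd : PBond (F.P (recordK₀ F Mc k + n)) 0 → Fin 2 → Fin 2 → ℂ := fun b' => recordHrLocξ F θ k (recordK₀ F Mc k + n) Finset.univ a (μ, y) b' -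
        recordHrLocξ F θ k (recordK₀ F Mc k + n) (recordWindow F k (recordK₀ F Mc k + n) R0 z₀) a (μ, y) b';
      ∀ b : PBond (F.P (recordK₀ F Mc k + n)) 0, coarsenTo (k + 1) b.src ∈ recordWindow F k (recordK₀ F Mc k + n) R3 z₀ →
        ‖Hd b‖ ≤ C₉' * (F.P (recordK₀ F Mc k + n)).eta (k + 1) * Real.exp (-(δ₉ * ((R0 : ℝ) - (R3 : ℝ)))) ∧
        (∀ ν : Fin (F.P (recordK₀ F Mc k + n)).d, ‖Hd ⟨b.src.shift ν, b.dir⟩ - Hd b‖ ≤ C₉' * (F.P (recordK₀ F Mc k + n)).eta (k + 1) ^ 2 * Real.exp (-(δ₉ * ((R0 : ℝ) - (R3 : ℝ))))) ∧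
        ‖∑ ν : Fin (F.P (recordK₀ F Mc k + n)).d, (Hd ⟨b.src.shift ν, b.dir⟩ - (2 : ℂ) • Hd b + Hd ⟨b.src.unshift ν, b.dir⟩)‖ ≤
          C₉' * (F.P (recordK₀ F Mc k + n)).eta (k + 1) ^ 3 * Real.exp (-(δ₉ * ((R0 : ℝ) - (R3 : ℝ)))) ∧
        ‖∑ ν : Fin (F.P (recordK₀ F Mc k + n)).d, ((Hd ⟨b.src, b.dir⟩ + Hd ⟨(b.src).shift b.dir, ν⟩ - Hd ⟨(b.src).shift ν, b.dir⟩ - Hd ⟨b.src, ν⟩) -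
          (Hd ⟨b.src.unshift ν, b.dir⟩ + Hd ⟨(b.src.unshift ν).shift b.dir, ν⟩ - Hd ⟨(b.src.unshift ν).shift ν, b.dir⟩ - Hd ⟨b.src.unshift ν, ν⟩))‖ ≤
          C₉' * (F.P (recordK₀ F Mc k + n)).eta (k + 1) ^ 3 * Real.exp (-(δ₉ * ((R0 : ℝ) - (R3 : ℝ)))))
    (α₂ : ℝ) (hα₂ : 0 < α₂) :
    ∃ C₉ δ₀ : ℝ, 0 ≤ C₉ ∧ 0 < δ₀ ∧ ∀ k : ℕ, ∀ ε₂₉ : ℝ, 0 < ε₂₉ →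
      (∀ a : (thetaFill F a₀ ε₂₉).ιβ, Response9DAtLocUnivξ F (thetaFill F a₀ ε₂₉) a Mc k (recordK₀ F Mc k) α₂ C₉ δ₀) ∧
      ∀ n : ℕ, letI θ := thetaFill F a₀ ε₂₉; letI := θ.instVβ₁; letI := θ.instVβ₂;
        (ContDiffAt ℝ 2 (recordEmbLocξ F θ k (recordK₀ F Mc k + n) Finset.univ) 0 ∧ recordEmbLocξ F θ k (recordK₀ F Mc k + n) Finset.univ 0 = 0) ∧
        ∀ a : θ.ιβ, ResponseRowAtLocξ F θ k (recordK₀ F Mc k + n) Finset.univ a :=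
  portPieceLocalityU8_LocUniv_of_clauses34 F Mc a₀ hMc (h34_of_clause3 F Mc a₀ h3) hcmp α₂ hα₂

end Summit.QuantumFields.YangMills.Theorems.PortU8

end
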